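import Summits.QuantumFields.BalabanUV.T4Continuum.Support.ShellMeasureWilsonGradientTail

/-!
# `T4Continuum.ShellMeasureLocalGradientTailJet` — WALL §2 (a) item (P4), one-grid face, file 3: THE JET DICTIONARY —
# `tail₂ (locGrad V)` IS the bond-localised functional derivative of the ORDER-≥3 PART `ord₃ V := V − V(0) − DV(0) −
# ½D²V(0)(·,·)` of an analytic functional, hence the (98) SHAPE holds for `locGrad (ord₃ 𝒲)` itself, `𝒲` the one-grid
# Wilson-type action at any unit-bounded background (cell `pub-balaban`, sub-cell `t4`, spine estimate NE7c (node U5b),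
# owner lineage `b2b-balaban-t4-ne7c-p1` gen 29, table `LEAVES-NE7c-P1.md` row S62 file 3; imports file 2
# `ShellMeasureWilsonGradientTail` (hence file 1) and uses `B13ExpansionOrder` (`homPart`) BY NAME; [folklore]; 0 sorry)

HONEST FRAMING.  Finite four-torus programme, rung (B)+1 only — NOT infinite volume, NOT a mass gap, NOT the Clay
problem, NOT summit progress; (B), `BetaPertHyp`, (B^μ) are not consumed.  NE7c (`T4IndicatorShell.ShellWeightBound`)
is NOT PRINTED and NOT PROVED; «NE7c ⇐ the named binders» (WALL `t4/b2b-balaban-t4-ne7c-p1/WALL-NE7c-P1.md` §2).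
Elementary calculus on complex normed spaces ([folklore]); nothing printed is asserted or cited as a fact; no
`def … : Prop` (the two `def`s are DATA: the 2-jet and the order-≥3 part of a scalar functional).  HONEST DEPENDENCY
(cell): continuum YM on T⁴ ⇐ BetaPertH ∧ nine spine estimates (0/9 proved); BetaPertH ⇐ (D1) ∧ (D4) ∧ CAP+tail;
G-an2-4 gates asym, D1 and NE2/3/4.

THE POINT.  Files 1–2 (`ShellMeasureLocalGradientTail`, `ShellMeasureWilsonGradientTail`, p220699∕p220909) proved END-II's
`hW` SHAPE `Prop4Hyp (tail₂ (locGrad 𝒲)) C₄ a₃` for the object `tail₂ (locGrad 𝒲)` = «the 2-tail of the local gradient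
map».  [Balaban1985Variational] defines its `V` by the WORDS (p. 290, (80)∕(81), locator only): *«Now let us write
higher order terms. They determine the functional V(A′) …»* — all terms of order ≥ 3 of the expansion of the action in
the chart — and bounds `(δ∕δA′)V`.  This file closes the gap between the two phrasings AT ONE GRID:
* §1 `jet₂ V A := V 0 + DV(0)A + ½·D²V(0)(A, A)`, `ord₃ V := V − jet₂ V`; `jet₂_eq_homPart`: for `V` analytic on a ball
  about `0`, `jet₂ V A = V 0 + homPart V 1 A + homPart V 2 A` — the census vocabulary of `B13ExpansionOrder` (so
  `ord₃ V` is «`V` minus its parts of order 0, 1, 2»).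
* §2 `hasFDerivAt_quadForm` (`D[A ↦ f''(A,A)] = f''(A,·) + f''(·,A)`), `fderiv_fderiv_symm` (`D²V(0)` symmetric for
  `V` analytic at `0` — Mathlib's `ContDiffAt.isSymmSndFDerivAt` over `ℂ`), `hasFDerivAt_half_quadForm`
  (`D[½f''(A,A)] = f''(A,·)`), `hasFDerivAt_ord₃` (`D(ord₃ V)(A) = DV(A) − DV(0) − D²V(0)(A,·)`).
* §3 **`locGrad_ord₃_eq_tail₂`** ∕ `locGrad_ord₃_eqOn`: for `V` analytic on `ball 0 R`,
  `locGrad (ord₃ V) = tail₂ (locGrad V)` ON THE BALL (`fderiv_locGrad_coord_zero`: the derivative at `0` of the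
  `b`-coordinate `A ↦ DV(A) ∘ ι_b` is `A ↦ D²V(0)(A,·) ∘ ι_b`).
* §4 `prop4Hyp_congr` (`Prop4Hyp` only sees `‖Y‖ < a₃`); **`prop4Hyp_locGrad_ord₃`** (local sums: `Prop4Hyp (locGrad
  (ord₃ V)) (32·m·M₀∕R³) (R∕2)`); **`prop4Hyp_wilsonV_ord₃`**: for the one-grid Wilson-type action
  `𝒲 = Σ_p τ(1 − (e^{iA}U₀)(∂p))` at ANY background with `‖U₀(b)‖, ‖U₀(b)⁻¹‖ ≤ 1` and `#st(b) ≤ m`,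
  `Prop4Hyp (locGrad (ord₃ 𝒲)) (32·m·‖τ‖(1 + e^{4R})∕R³) (R∕2)` for every `R > 0` — B11 (90)∕(97)∕(98) TYPE at
  `Lʲη = η` for «all terms of order ≥ 3» literally, constants from `m`, `‖τ‖`, `R` only.
NOT HERE (said in the headlines): the multi-scale gain of (97) on `Ω_j`, `j ≥ 1` (row S65), the `HD`-terms and
commutator terms of (80) (row S66; they consume (46) = the deep wall and the `Cf` item), the printed `η`-currency and
the `M_N(ℂ)`∕SU(N) instance (row S63), the [dict] identification with END-II's `W𝒱 V` (node O).  No estimate of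
Bałaban's at a live level is discharged.
-/

noncomputable section

open Metric Set Filter
open scoped Topology

namespace Summit.QuantumFields.BalabanUV.T4Continuum.ShellMeasureLocalGradientTailJet

open Literature.MathematicalPhysics.QuantumFieldTheory.Balaban1983to89
open B13ExpansionOrder (homPart homPart_one homPart_two_eq)
open B11Prop6Scheme (Prop4Hyp)
open ShellMeasureLocalGradientTail (tail₂ sgl locGrad locGrad_apply tail₂_pi_apply prop4Hyp_locGrad analyticOnNhd_sum)
open ShellMeasureWilsonGradientTail (plaqFun bonds wilsonV analyticAt_plaqFun norm_plaqFun_le_of_mem_ball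
  plaqFun_add_single)

variable {E : Type*} [NormedAddCommGroup E] [NormedSpace ℂ E]

/-! ## §1 The 2-jet and the order-≥3 part of a scalar functional -/

/-- The 2-JET of `V` at the origin: `V(0) + DV(0)A + ½·D²V(0)(A, A)`. [folklore] -/
def jet₂ (V : E → ℂ) (A : E) : ℂ := V 0 + fderiv ℂ V 0 A + (2 : ℂ)⁻¹ * fderiv ℂ (fderiv ℂ V) 0 A A

/-- THE ORDER-≥3 PART of `V` at the origin: `ord₃ V := V − jet₂ V` — [Balaban1985Variational] (80)∕(81): *«Now let us
write higher order terms. They determine the functional V(A′)»*, `V` = all terms of order ≥ 3 of the expansion of the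
action in the chart (locator only). [folklore] -/
def ord₃ (V : E → ℂ) (A : E) : ℂ := V A - jet₂ V A

/-- Unfolding. [folklore] -/
theorem ord₃_apply (V : E → ℂ) (A : E) :
    ord₃ V A = V A - V 0 - fderiv ℂ V 0 A - (2 : ℂ)⁻¹ * fderiv ℂ (fderiv ℂ V) 0 A A := by
  simp only [ord₃, jet₂]
  ring

/-- `ord₃ V 0 = 0`. [folklore] -/
theorem ord₃_zero (V : E → ℂ) : ord₃ V 0 = 0 := by
  simp [ord₃, jet₂]

/-- The 2-jet in the census vocabulary of `B13ExpansionOrder`: `jet₂ V A = V 0 + homPart V 1 A + homPart V 2 A` for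
`V` analytic on a ball about `0`. [folklore] -/
theorem jet₂_eq_homPart {V : E → ℂ} {R : ℝ} (hR : 0 < R) (hV : AnalyticOnNhd ℂ V (ball 0 R)) (A : E) :
    jet₂ V A = V 0 + homPart V 1 A + homPart V 2 A := by
  have hd : DifferentiableAt ℂ V 0 := (hV 0 (mem_ball_self hR)).differentiableAt
  have h2 : fderiv ℂ (fun z => fderiv ℂ V z A) 0 A = fderiv ℂ (fderiv ℂ V) 0 A A := by
    have hc : HasFDerivAt (fderiv ℂ V) (fderiv ℂ (fderiv ℂ V) 0) 0 :=
      ((hV 0 (mem_ball_self hR)).fderiv.differentiableAt).hasFDerivAt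
    have h := hc.clm_apply (hasFDerivAt_const A (0 : E))
    rw [h.fderiv]
    simp
  rw [jet₂, homPart_one hd, homPart_two_eq hR hV, h2, smul_eq_mul]

/-! ## §2 The derivative of the quadratic term and the symmetry of `D²V(0)` -/

/-- The derivative of the quadratic form `A ↦ D²V(0)(A, A)`: `h ↦ D²V(0)(A, h) + D²V(0)(h, A)`. [folklore] -/
theorem hasFDerivAt_quadForm (f'' : E →L[ℂ] E →L[ℂ] ℂ) (A : E) :
    HasFDerivAt (fun A => f'' A A) (f'' A + f''.flip A) A := by
  have h := (f''.hasFDerivAt (x := A)).clm_apply (hasFDerivAt_id A)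
  have he : (f'' A).comp (ContinuousLinearMap.id ℂ E) + f''.flip (id A) = f'' A + f''.flip A := by
    ext h
    simp
  rw [he] at h
  exact h

/-- `D²V(0)` is symmetric for `V` analytic near `0` (Mathlib's `ContDiffAt.isSymmSndFDerivAt`). [folklore] -/
theorem fderiv_fderiv_symm {V : E → ℂ} (hV : AnalyticAt ℂ V 0) (v w : E) :
    fderiv ℂ (fderiv ℂ V) 0 v w = fderiv ℂ (fderiv ℂ V) 0 w v :=
  (hV.contDiffAt (n := ⊤)).isSymmSndFDerivAt (by simp) v w

/-- Hence the derivative of `A ↦ ½·D²V(0)(A, A)` at `A` is `D²V(0)(A, ·)`. [folklore] -/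
theorem hasFDerivAt_half_quadForm {V : E → ℂ} (hV : AnalyticAt ℂ V 0) (A : E) :
    HasFDerivAt (fun A => (2 : ℂ)⁻¹ * fderiv ℂ (fderiv ℂ V) 0 A A) (fderiv ℂ (fderiv ℂ V) 0 A) A := by
  have h := (hasFDerivAt_quadForm (fderiv ℂ (fderiv ℂ V) 0) A).const_mul (2 : ℂ)⁻¹
  have he : (2 : ℂ)⁻¹ • (fderiv ℂ (fderiv ℂ V) 0 A + (fderiv ℂ (fderiv ℂ V) 0).flip A) =
      fderiv ℂ (fderiv ℂ V) 0 A := by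
    ext h
    change (2 : ℂ)⁻¹ * (fderiv ℂ (fderiv ℂ V) 0 A h + fderiv ℂ (fderiv ℂ V) 0 h A) = fderiv ℂ (fderiv ℂ V) 0 A h
    rw [fderiv_fderiv_symm hV h A]
    ring
  rw [he] at h
  exact h

/-- The derivative of `ord₃ V` at a point `A` where `V` is differentiable (and analytic at `0`):
`D(ord₃ V)(A) = DV(A) − DV(0) − D²V(0)(A, ·)`. [folklore] -/
theorem hasFDerivAt_ord₃ {V : E → ℂ} (hV0 : AnalyticAt ℂ V 0) {A : E}
    (hVA : DifferentiableAt ℂ V A) :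
    HasFDerivAt (ord₃ V) (fderiv ℂ V A - fderiv ℂ V 0 - fderiv ℂ (fderiv ℂ V) 0 A) A := by
  have h1 : HasFDerivAt (fun A => V A - V 0 - fderiv ℂ V 0 A) (fderiv ℂ V A - fderiv ℂ V 0) A := by
    have h := (hVA.hasFDerivAt.sub_const (V 0)).sub ((fderiv ℂ V 0).hasFDerivAt (x := A))
    exact h
  have h2 := h1.sub (hasFDerivAt_half_quadForm hV0 A)
  refine h2.congr_of_eventuallyEq (Eventually.of_forall fun A' => ?_)
  simp only [Pi.sub_apply, ord₃_apply]

/-! ## §3 THE DICTIONARY: `tail₂ (locGrad V)` IS the bond-local derivative of the order-≥3 part of `V` -/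

section Local

variable {Λ : Type*} [Fintype Λ] [DecidableEq Λ] {𝔄 : Type*} [NormedAddCommGroup 𝔄] [NormedSpace ℂ 𝔄]

/-- The derivative at `0` of the `b`-coordinate of `locGrad V`, applied to `A`, is `D²V(0)(A, ·) ∘ ι_b`. [folklore] -/
theorem fderiv_locGrad_coord_zero {V : (Λ → 𝔄) → ℂ} {R : ℝ} (hR : 0 < R) (hV : AnalyticOnNhd ℂ V (ball 0 R))
    (b : Λ) (A : Λ → 𝔄) :
    fderiv ℂ (fun A => locGrad V A b) 0 A = (fderiv ℂ (fderiv ℂ V) 0 A).comp (sgl b) := by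
  have hc : HasFDerivAt (fderiv ℂ V) (fderiv ℂ (fderiv ℂ V) 0) 0 :=
    ((hV 0 (mem_ball_self hR)).fderiv.differentiableAt).hasFDerivAt
  have h := hc.clm_comp (hasFDerivAt_const (sgl b : 𝔄 →L[ℂ] (Λ → 𝔄)) (0 : Λ → 𝔄))
  simp only [locGrad_apply]
  rw [h.fderiv]
  ext X
  simp

/-- **THE JET DICTIONARY (one grid).**  For `V` analytic on `ball 0 R` and `A` in the ball:
`locGrad (ord₃ V) A b = tail₂ (locGrad V) A b` for every bond `b` — S62's object `W𝒱 := tail₂ (locGrad 𝒲)` IS the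
bond-localised functional derivative of «all terms of order ≥ 3» of the one-grid action (B11 (80)∕(81)∕(90) TYPE;
nothing printed is asserted). [folklore] -/
theorem locGrad_ord₃_eq_tail₂ {V : (Λ → 𝔄) → ℂ} {R : ℝ} (hR : 0 < R) (hV : AnalyticOnNhd ℂ V (ball 0 R))
    {A : Λ → 𝔄} (hA : A ∈ ball (0 : Λ → 𝔄) R) (b : Λ) :
    locGrad (ord₃ V) A b = tail₂ (locGrad V) A b := by
  have hV0 : AnalyticAt ℂ V 0 := hV 0 (mem_ball_self hR)
  have hVA : DifferentiableAt ℂ V A := (hV A hA).differentiableAt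
  -- left side: the derivative of `ord₃ V` at `A`, composed with `ι_b`
  rw [locGrad_apply, (hasFDerivAt_ord₃ hV0 hVA).fderiv]
  -- right side: coordinatewise tail
  have hcoord : ∀ b, DifferentiableAt ℂ (fun A => locGrad V A b) 0 := fun b =>
    ((hV0.fderiv).differentiableAt).clm_comp (differentiableAt_const (sgl b))
  rw [tail₂_pi_apply (W := locGrad V) hcoord A b,
    show tail₂ (fun A => locGrad V A b) A = locGrad V A b - locGrad V 0 b - fderiv ℂ (fun A => locGrad V A b) 0 A
      from rfl,
    fderiv_locGrad_coord_zero hR hV b A]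
  simp only [locGrad_apply, ContinuousLinearMap.sub_comp]

/-- … as an identity of `𝒵`-valued maps on the ball: `locGrad (ord₃ V) = tail₂ (locGrad V)` there. [folklore] -/
theorem locGrad_ord₃_eqOn {V : (Λ → 𝔄) → ℂ} {R : ℝ} (hR : 0 < R) (hV : AnalyticOnNhd ℂ V (ball 0 R)) :
    EqOn (locGrad (ord₃ V)) (tail₂ (locGrad V)) (ball (0 : Λ → 𝔄) R) := fun _ hA =>
  funext fun b => locGrad_ord₃_eq_tail₂ hR hV hA b

/-! ## §4 The (98) SHAPE stated for the order-≥3 part itself -/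

omit [Fintype Λ] [DecidableEq Λ] in
/-- `Prop4Hyp` only sees the open ball `‖Y‖ < a₃`: it transfers along equality there. [folklore] -/
theorem prop4Hyp_congr {𝒴 𝒵 : Type*} [NormedAddCommGroup 𝒴] [NormedSpace ℂ 𝒴] [NormedAddCommGroup 𝒵]
    [NormedSpace ℂ 𝒵] {W W' : 𝒴 → 𝒵} {C a : ℝ} (h : Prop4Hyp W C a) (heq : EqOn W' W {Y | ‖Y‖ < a}) :
    Prop4Hyp W' C a where
  quad Y hY := by
    rw [heq hY]
    exact h.quad Y hY
  differentiableOn := h.differentiableOn.congr heq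

variable {P : Type*} (Pl : Finset P)

/-- **THE (98) SHAPE FOR THE ORDER-≥3 PART OF A LOCAL SUM** (file 1's `prop4Hyp_locGrad` transported along the jet
dictionary): `Prop4Hyp (locGrad (ord₃ V)) (32·m·M₀∕R³) (R∕2)`. [folklore] -/
theorem prop4Hyp_locGrad_ord₃ (φ : P → (Λ → 𝔄) → ℂ) (supp : P → Finset Λ) {R M₀ : ℝ} {m : ℕ} (hR : 0 < R)
    (hM₀ : 0 ≤ M₀) (ha : ∀ p ∈ Pl, AnalyticOnNhd ℂ (φ p) (ball 0 R))
    (hM : ∀ p ∈ Pl, ∀ A ∈ ball (0 : Λ → 𝔄) R, ‖φ p A‖ ≤ M₀)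
    (hloc : ∀ p ∈ Pl, ∀ A : Λ → 𝔄, ∀ b ∉ supp p, ∀ X : 𝔄, φ p (A + Pi.single b X) = φ p A)
    (hm : ∀ b : Λ, (Pl.filter (fun p => b ∈ supp p)).card ≤ m) :
    Prop4Hyp (locGrad (ord₃ (fun A => ∑ p ∈ Pl, φ p A))) (32 * m * M₀ / R ^ 3) (R / 2) :=
  prop4Hyp_congr (prop4Hyp_locGrad Pl φ supp hR hM₀ ha hM hloc hm) fun A hA => by
    have hA' : ‖A‖ < R / 2 := hA
    exact locGrad_ord₃_eqOn hR (analyticOnNhd_sum Pl φ ha) (mem_ball_zero_iff.2 (by linarith))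

/-- **THE (98) SHAPE FOR THE ORDER-≥3 PART OF THE ONE-GRID WILSON-TYPE ACTION** at ANY unit-bounded background
(`𝔸` a complete normed `ℂ`-algebra with `‖1‖ = 1`): `Prop4Hyp (locGrad (ord₃ 𝒲)) (32·m·‖τ‖(1 + e^{4R})∕R³) (R∕2)` —
B11 (90)∕(97) TYPE at `Lʲη = η` for «all terms of order ≥ 3» of `𝒲 = Σ_p τ(1 − (e^{iA}U₀)(∂p))`, constants from the
incidence number `m`, `‖τ‖` and `R` ONLY.  NOT the multi-scale gain on `Ω_j`, NOT the `HD`-terms, NOT the [dict].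
[folklore] -/
theorem prop4Hyp_wilsonV_ord₃ {𝔸 : Type*} [NormedRing 𝔸] [NormedAlgebra ℂ 𝔸] [CompleteSpace 𝔸] [NormOneClass 𝔸]
    (bd : P → Fin 4 → Λ × Bool) (τ : 𝔸 →L[ℂ] ℂ) (U : Λ → 𝔸ˣ) (hU : ∀ b, ‖(U b : 𝔸)‖ ≤ 1)
    (hU' : ∀ b, ‖(((U b)⁻¹ : 𝔸ˣ) : 𝔸)‖ ≤ 1) {m : ℕ} (hm : ∀ b : Λ, (Pl.filter (fun p => b ∈ bonds (bd p))).card ≤ m)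
    {R : ℝ} (hR : 0 < R) :
    Prop4Hyp (locGrad (ord₃ (wilsonV Pl bd τ U))) (32 * m * (‖τ‖ * (1 + Real.exp (4 * R))) / R ^ 3) (R / 2) :=
  prop4Hyp_locGrad_ord₃ Pl (fun p => plaqFun τ U (bd p)) (fun p => bonds (bd p)) hR (by positivity)
    (fun p _ A _ => analyticAt_plaqFun hU hU' τ (bd p) A)
    (fun p _ A hA => norm_plaqFun_le_of_mem_ball hU hU' τ (bd p) hA)
    (fun p _ A b hb X => plaqFun_add_single τ U (bd p) A hb X) hm

end Local

end Summit.QuantumFields.BalabanUV.T4Continuum.ShellMeasureLocalGradientTailJet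

end
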